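import Summits.Ventures.Crystal3D.Theorems.StickyWulffConstantGenericWallFloorBarlowHRowFamily
import Summits.Ventures.Crystal3D.Theorems.StickyWulffConstantGenericWallFloorBarlowRowTwinFamily
import Summits.Ventures.Crystal3D.Theorems.StickyWulffConstantGenericWallFloorLayerRowsLedger
import Summits.Ventures.Crystal3D.Theorems.StickyWulffConstantGenericWallFloorLayerRowsApartDefs
import Summits.Ventures.Crystal3D.Theorems.StickyWulffConstantGenericWallFloorBarlowRowLineCount
import Summits.Ventures.Crystal3D.Theorems.StickyWulffConstantTextureLiminfTexShadowLayerRowsDefs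
import Summits.Ventures.Crystal3D.Theorems.StickyWulffConstantTextureLiminfZigOrRows
import HarnessLib

/-!
# LAYER ROWS R1: `barlow_layerRows_inPlane_at` — the in-layer row machine of an EDGE-ON plate certifies lane T's
# `LayerRowsCertifiedAt` / `LayerRowsMachine` (crux `GenericWallFloor`, stmt-Ventures-19480, kernel G; cf-p1 RULINGS (ccix)–(ccxiii), step (iv);
# consumer: lane T's EDGE-ON flux sliver `stub_edgeOnFlux` of `TextureLiminfV5`, stmt-Ventures-23912, via 19480-p1's `edgeOnFlux_of_layerRowsMachine`)

HONEST FRAMING. Venture `Summits/Ventures/Crystal3D` (cell `crystal3d-full`), route `route-Ventures-StickyWulffConstant`, helper for the crux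
`GenericWallFloor` (stmt-Ventures-19480) / consumer `TextureLiminfV5` (stmt-Ventures-23912).  The assembly of the LAYER ROWS line; inputs BY NAME:
E1 (`ExactOnly`, P₅ — `stub_E1`), `DoubleStarCoaxialAt` / `CapPairCoaxial` (from `StarPairFar`), **`HStarModel`** (E1h, pattern A12-583 —
`stub_E1h`) and **`HRowEndFar`** ((J-b) — `stub_hRowEndFar`, RULING (ccxiii)(A)); the apartness regime is `LayerRowsApartReg` (its complement is
lane T's measure-zero read class `RowReadAt`, 19480-p1).  F-C1 not moved.

THE MACHINE.  In a wall cell whose bottom plate `P₁ = stacking L₁ s₀ σ₁ ∩ [−2R₀, −R₀]` is within `arcsin √(1/20)` of edge-on, the best in-layer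
bond `w₁ = bestLayerDir L₁ e₃` rises by `layerRise ≥ √(57/80) ≥ 3/4` (`three_quarters_lateral_le_layerRise_sq`).  Every in-layer ROW `(k, j)` of
plate 1 crossing the band `[−R₀−4, −R₀−3]` at lateral `≤ ρ − m` (`m = 7 + (8/3)(h + 4R₀)`) launches ONE walker along `L₁ w₁` from its lowest site
above `−R₀−4` (`rowSet_of_sites`, `rowLineFamily_spec`): on a «++» c-layer the stack walker `⟨L₁, w₁, 0⟩` (`rowBottomFamily_spec_apart`), on a «−−»
c-layer the stack walker of the basal twin grain `⟨twinFrame L₁ (L₁ e₃), w₁, 0⟩` (`rowTwinFamily_spec_apart`), on an h-layer the cap-free h-row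
walker (`hRow_member_A/B`).  All end in `PAY = {deg ≠ 12, −R₀−2 ≤ y₂ ≤ h+R₀+2}` and the three families pay together (`layerRows_card_le_payers`:
twin cross pairs priced by (TG)+(BB), h-ends disjoint from c-ends by `HRowEndFar`, distinct rows give distinct h-ends by `layerRow_end_eq`):
`#T ≤ Σ_PAY (12 − deg)`.
* `barlow_layerRows_le_payers` — the cell statement (any `R₀ ≥ 6`, steep `w₁` given);
* `layerRise_sq_ge_of_tilt`, `rise_bestLayerDir_of_tilt` — edge-on ⇒ `(L₁ w₁)₂ ≥ 3/4` and `≥ √2/2`;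
* **`barlow_layerRows_inPlane_at : … → HStarModel → HRowEndFar → LayerRowsMachine LayerRowsApartReg 2046`** (`R₀ = 10`, `18·m·ρ ≤ 2046(1+h)ρ`).
WHAT THIS IS NOT: E1, E1h, (J-b), StarPairFar stay named; the read class `¬LayerRowsApart` is lane T's cut; F-C1 not moved.
-/

noncomputable section

namespace Summit.Ventures.Crystal3D.Theorems

open Finset
open Literature.MathematicalPhysics.StatisticalMechanics
open Summit.Ventures.Crystal3D.Cruxes.TextureLiminf.TexShadow (stacking bestLayerDir layerRise LayerRowsMachine LayerRowsCertifiedAt cyl)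
open scoped InnerProductSpace

variable {X : Finset (EuclideanSpace ℝ (Fin 3))}

/-! ### The cell statement -/

section Cell

variable (σ₁ : ℤ → ℤ) (L₁ : EuclideanSpace ℝ (Fin 3) ≃ₗᵢ[ℝ] EuclideanSpace ℝ (Fin 3)) (s₀ : EuclideanSpace ℝ (Fin 3))

open scoped Classical in
/-- **LAYER ROWS, cell form.**  In the wall cell, with `w₁ = bestLayerDir L₁ e₃` steep (`⟪L₁ w₁, e₃⟫ ≥ √2/2` and `≥ 3/4`) and the frames apart
(`LayerRowsApart L₁ L₂`), the set `T` of rows of plate 1 through the window balls contains every row with a site of height in `[−R₀−4, −R₀−3]` at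
lateral `≤ ρ − (7 + (8/3)(h+4R₀))`, and `#T ≤ Σ_PAY (12 − deg)`. -/
theorem barlow_layerRows_le_payers (hX : ∀ p ∈ X, ∀ q ∈ X, p ≠ q → 1 ≤ dist p q)
    {sE : EuclideanSpace ℝ (Fin 3)} (hsE : sE ∈ fccSlots) (hcert : ExactOnly 0 (fccSlots.filter fun w => 0 < ⟪w, sE⟫_ℝ))
    (hDS : ∀ F₁ F₂ : EuclideanSpace ℝ (Fin 3) ≃ₗᵢ[ℝ] EuclideanSpace ℝ (Fin 3), DoubleStarCoaxialAt F₁ F₂) (hCP : CapPairCoaxial)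
    (hModel : HStarModel) (hJ : HRowEndFar)
    (hσ₁ : IsHaggSeq σ₁) {σ₂ : ℤ → ℤ} (hσ₂ : IsHaggSeq σ₂)
    (L₂ : EuclideanSpace ℝ (Fin 3) ≃ₗᵢ[ℝ] EuclideanSpace ℝ (Fin 3)) (s₂ : EuclideanSpace ℝ (Fin 3))
    (R₀ h ρ : ℝ) (hR₀ : 6 ≤ R₀) (hh : 0 ≤ h) (hρ : 1 ≤ ρ) (P₁ P₂ : Finset (EuclideanSpace ℝ (Fin 3))) (hP₁X : P₁ ⊆ X) (hP₂X : P₂ ⊆ X)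
    (hcell : ∀ p ∈ X, -(2 * R₀) ≤ p 2 ∧ p 2 ≤ h + 2 * R₀ ∧ p 0 ^ 2 + p 1 ^ 2 ≤ ρ ^ 2)
    (hP₁ : ∀ p, p ∈ P₁ ↔ (p ∈ stacking L₁ s₀ σ₁ ∧ -(2 * R₀) ≤ p 2 ∧ p 2 ≤ -R₀ ∧ p 0 ^ 2 + p 1 ^ 2 ≤ ρ ^ 2))
    (hP₂ : ∀ p, p ∈ P₂ ↔ (p ∈ stacking L₂ s₂ σ₂ ∧ h + R₀ ≤ p 2 ∧ p 2 ≤ h + 2 * R₀ ∧ p 0 ^ 2 + p 1 ^ 2 ≤ ρ ^ 2))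
    (hsteep : Real.sqrt 2 / 2 ≤ ⟪L₁ (bestLayerDir L₁ (EuclideanSpace.single (2 : Fin 3) (1 : ℝ))), EuclideanSpace.single (2 : Fin 3) (1 : ℝ)⟫_ℝ)
    (hrise : (3 / 4 : ℝ) ≤ (L₁ (bestLayerDir L₁ (EuclideanSpace.single (2 : Fin 3) (1 : ℝ)))) 2)
    (hapart : LayerRowsApart L₁ L₂) :
    ∃ T : Finset (ℤ × ℤ),
      (∀ kj : ℤ × ℤ, (∃ i : ℤ,
        -R₀ - 4 ≤ (L₁ (layerSite σ₁ L₁ (EuclideanSpace.single (2 : Fin 3) (1 : ℝ)) kj.1 i kj.2) + s₀) 2 ∧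
        (L₁ (layerSite σ₁ L₁ (EuclideanSpace.single (2 : Fin 3) (1 : ℝ)) kj.1 i kj.2) + s₀) 2 ≤ -R₀ - 3 ∧
        Real.sqrt ((L₁ (layerSite σ₁ L₁ (EuclideanSpace.single (2 : Fin 3) (1 : ℝ)) kj.1 i kj.2) + s₀) 0 ^ 2 +
          (L₁ (layerSite σ₁ L₁ (EuclideanSpace.single (2 : Fin 3) (1 : ℝ)) kj.1 i kj.2) + s₀) 1 ^ 2) ≤ ρ - (7 + 8 / 3 * (h + 4 * R₀))) →
        kj ∈ T) ∧
      (T.card : ℝ) ≤ ∑ y ∈ X.filter (fun y => (X.filter fun q => dist y q = 1).card ≠ 12 ∧ -R₀ - 2 ≤ y 2 ∧ y 2 ≤ h + R₀ + 2),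
          ((12 : ℝ) - ((X.filter fun q => dist y q = 1).card : ℝ)) := by
  set e₃ : EuclideanSpace ℝ (Fin 3) := EuclideanSpace.single (2 : Fin 3) (1 : ℝ) with he₃
  have he₃n : ‖e₃‖ = 1 := by rw [he₃, PiLp.norm_single, norm_one]
  have he₃i : ∀ d : EuclideanSpace ℝ (Fin 3), ⟪d, e₃⟫_ℝ = d 2 := fun d => by rw [he₃, EuclideanSpace.inner_single_right]; simp
  set w₁ : EuclideanSpace ℝ (Fin 3) := bestLayerDir L₁ e₃ with hw₁def
  set G₁ : EuclideanSpace ℝ (Fin 3) ≃ₗᵢ[ℝ] EuclideanSpace ℝ (Fin 3) := twinFrame L₁ (L₁ e₃) with hG₁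
  have hw₁s : w₁ ∈ fccSlots := bestLayerDir_mem_fccSlots L₁ e₃
  have hw₁2 : w₁ 2 = 0 := Summit.Ventures.Crystal3D.Cruxes.TextureLiminf.TexShadow.bestLayerDir_apply_two L₁ e₃
  obtain ⟨a₀, b₀, a₁, b₁, hdet, hw₁, hw₁'⟩ := exists_rowCoeffs L₁ e₃
  set bp : ℤ → ℤ → ℤ → EuclideanSpace ℝ (Fin 3) := fun m a b => barlowPos 1 (Real.sqrt (2 / 3)) σ₁ m a b with hbp
  set PAY := X.filter (fun y => (X.filter fun q => dist y q = 1).card ≠ 12 ∧ -R₀ - 2 ≤ y 2 ∧ y 2 ≤ h + R₀ + 2) with hPAYdef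
  have hs2 : (0 : ℝ) < Real.sqrt 2 / 2 := by positivity
  have hR₀4 : (4 : ℝ) ≤ R₀ := by linarith
  -- margin and radii
  set m : ℝ := 7 + 8 / 3 * (h + 4 * R₀) with hm
  have hm0 : 0 ≤ m := by rw [hm]; positivity
  set ρw : ℝ := ρ - m with hρw
  set ρin : ℝ := ρw + 2 with hρin
  have hρin' : ρin + 8 / 3 * (h + 4 * R₀) + 2 ≤ ρ - 1 := by rw [hρin, hρw, hm]; linarith
  have hinvδ : 1 / (Real.sqrt 2 / 2) ≤ 2 := by
    rw [div_le_iff₀ hs2]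
    have : (1 : ℝ) ≤ Real.sqrt 2 := by
      rw [show (1 : ℝ) = Real.sqrt 1 by simp]; exact Real.sqrt_le_sqrt (by norm_num)
    linarith
  -- apartness in the three forms
  have hapart_pp : ∀ F ∈ insert (twinFrame L₁ (L₁ e₃)) (chainFrames e₃ L₁ w₁),
      F '' fccStacking 1 (Real.sqrt (2 / 3)) ≠ L₂ '' fccStacking 1 (Real.sqrt (2 / 3)) ∧
      F '' fccStacking 1 (Real.sqrt (2 / 3)) ≠ (twinFrame L₂ (L₂ e₃)) '' fccStacking 1 (Real.sqrt (2 / 3)) := by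
    intro F hF
    rcases Set.mem_insert_iff.1 hF with rfl | hF
    · exact hapart.twinBase
    · exact hapart.of_mem_left hF
  have hapart_mm : ∀ F ∈ chainFrames e₃ G₁ w₁,
      F '' fccStacking 1 (Real.sqrt (2 / 3)) ≠ L₂ '' fccStacking 1 (Real.sqrt (2 / 3)) ∧
      F '' fccStacking 1 (Real.sqrt (2 / 3)) ≠ (twinFrame L₂ (L₂ e₃)) '' fccStacking 1 (Real.sqrt (2 / 3)) :=
    fun F hF => hapart.of_mem_right hF
  have hapart_h : L₁ '' fccStacking 1 (Real.sqrt (2 / 3)) ≠ L₂ '' fccStacking 1 (Real.sqrt (2 / 3)) ∧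
      L₁ '' fccStacking 1 (Real.sqrt (2 / 3)) ≠ (twinFrame L₂ (L₂ e₃)) '' fccStacking 1 (Real.sqrt (2 / 3)) := hapart.base
  -- the window balls and their row set
  set W₁ : Finset (EuclideanSpace ℝ (Fin 3)) := P₁.filter fun q => -R₀ - 4 ≤ q 2 ∧ q 2 ≤ -R₀ - 3 ∧ Real.sqrt (q 0 ^ 2 + q 1 ^ 2) ≤ ρw
    with hW₁
  have hW₁site : ∀ q ∈ W₁, ∃ k i j : ℤ, q = L₁ (barlowPos 1 (Real.sqrt (2 / 3)) σ₁ k i j) + s₀ := by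
    intro q hq
    obtain ⟨hqP, -⟩ := Finset.mem_filter.1 hq
    obtain ⟨r, ⟨k, i, j, rfl⟩, hr⟩ := ((hP₁ q).1 hqP).1
    exact ⟨k, i, j, hr.symm⟩
  obtain ⟨Tr, hTrin, hTrout, -⟩ := rowSet_of_sites σ₁ L₁ s₀ e₃ hdet hw₁ hw₁' W₁ hW₁site
  -- the window property and the crossing family of ALL rows
  have hwin : ∀ kj ∈ Tr, ∃ i : ℤ, (-R₀ - 4) ≤ ⟪L₁ (layerSite σ₁ L₁ e₃ kj.1 i kj.2) + s₀, e₃⟫_ℝ ∧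
      ⟪L₁ (layerSite σ₁ L₁ e₃ kj.1 i kj.2) + s₀, e₃⟫_ℝ ≤ (-R₀ - 4) + 1 ∧
      Real.sqrt ((L₁ (layerSite σ₁ L₁ e₃ kj.1 i kj.2) + s₀) 0 ^ 2 + (L₁ (layerSite σ₁ L₁ e₃ kj.1 i kj.2) + s₀) 1 ^ 2) ≤ ρw := by
    intro kj hkj
    obtain ⟨i, hi⟩ := hTrout kj hkj
    obtain ⟨-, h1, h2, h3⟩ := Finset.mem_filter.1 hi
    exact ⟨i, by rw [he₃i]; exact h1, by rw [he₃i]; linarith, h3⟩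
  obtain ⟨ai, bi, hfam⟩ := rowLineFamily_spec σ₁ L₁ s₀ e₃ hdet hw₁ hw₁' hs2 hsteep (-R₀ - 4) ρw Tr hwin
  -- the start of row `kj` and its bounds
  set pos : ℤ × ℤ → EuclideanSpace ℝ (Fin 3) := fun kj => L₁ (bp kj.1 (ai kj) (bi kj)) + s₀ with hpos
  have hposlo : ∀ kj ∈ Tr, -R₀ - 4 ≤ (pos kj) 2 := fun kj hkj => by rw [← he₃i]; exact (hfam kj hkj).2.1
  have hposhi : ∀ kj ∈ Tr, (pos kj) 2 ≤ -R₀ - 3 := fun kj hkj => by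
    have := (hfam kj hkj).2.2.1; rw [he₃i] at this; simp only [hpos]; linarith
  have hposlat : ∀ kj ∈ Tr, Real.sqrt ((pos kj) 0 ^ 2 + (pos kj) 1 ^ 2) ≤ ρin := fun kj hkj => by
    have := (hfam kj hkj).2.2.2.2.1; simp only [hpos]; rw [hρin]; linarith
  have hpossite : ∀ kj ∈ Tr, ∃ i : ℤ, pos kj = L₁ (layerSite σ₁ L₁ e₃ kj.1 i kj.2) + s₀ := fun kj hkj => by
    obtain ⟨i, hi⟩ := (hfam kj hkj).1; exact ⟨i, by simp only [hpos, hbp]; rw [hi]⟩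
  -- fuel
  set N : ℕ := ⌈8 * (h + 4 * R₀) / 3⌉₊ + 1 with hN
  have hNfuel : 8 * (h + 4 * R₀) < 3 * (N : ℝ) := by
    rw [hN]; push_cast
    have h1 := Nat.le_ceil (8 * (h + 4 * R₀) / 3)
    linarith
  have hNfuel' : h + 4 * R₀ ≤ 3 / 4 * (N : ℝ) := by
    have : 0 ≤ h + 4 * R₀ := by positivity
    linarith
  -- the partition of the rows by layer type
  set Tc : Finset (ℤ × ℤ) := Tr.filter fun kj => σ₁ kj.1 = σ₁ (kj.1 - 1) with hTc
  set Th : Finset (ℤ × ℤ) := Tr.filter fun kj => ¬ σ₁ kj.1 = σ₁ (kj.1 - 1) with hTh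
  set Tpp : Finset (ℤ × ℤ) := Tc.filter fun kj => σ₁ kj.1 = 1 with hTpp
  set Tmm : Finset (ℤ × ℤ) := Tc.filter fun kj => ¬ σ₁ kj.1 = 1 with hTmm
  have hcardTr : Tr.card = Tpp.card + Tmm.card + Th.card := by
    have h1 := Finset.card_filter_add_card_filter_not (s := Tr) (fun kj => σ₁ kj.1 = σ₁ (kj.1 - 1))
    have h2 := Finset.card_filter_add_card_filter_not (s := Tc) (fun kj => σ₁ kj.1 = 1)
    rw [← hTc, ← hTh] at h1
    rw [← hTpp, ← hTmm] at h2
    omega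
  have hTppTr : ∀ kj ∈ Tpp, kj ∈ Tr := fun kj hkj => (Finset.mem_filter.1 (Finset.mem_filter.1 hkj).1).1
  have hTmmTr : ∀ kj ∈ Tmm, kj ∈ Tr := fun kj hkj => (Finset.mem_filter.1 (Finset.mem_filter.1 hkj).1).1
  have hThTr : ∀ kj ∈ Th, kj ∈ Tr := fun kj hkj => (Finset.mem_filter.1 hkj).1
  have hcc : ∀ kj ∈ Tpp, σ₁ kj.1 = 1 ∧ σ₁ (kj.1 - 1) = 1 := fun kj hkj => by
    obtain ⟨hc, h1⟩ := Finset.mem_filter.1 hkj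
    obtain ⟨-, heq⟩ := Finset.mem_filter.1 hc
    exact ⟨h1, by rw [← heq, h1]⟩
  have hmm : ∀ kj ∈ Tmm, σ₁ kj.1 = -1 ∧ σ₁ (kj.1 - 1) = -1 := fun kj hkj => by
    obtain ⟨hc, h1⟩ := Finset.mem_filter.1 hkj
    obtain ⟨-, heq⟩ := Finset.mem_filter.1 hc
    have hk : σ₁ kj.1 = -1 := (hσ₁ kj.1).resolve_left h1
    exact ⟨hk, by rw [← heq, hk]⟩
  have hAB : ∀ kj ∈ Th, (σ₁ (kj.1 - 1) = -1 ∧ σ₁ kj.1 = 1) ∨ (σ₁ (kj.1 - 1) = 1 ∧ σ₁ kj.1 = -1) := fun kj hkj => by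
    obtain ⟨-, hne⟩ := Finset.mem_filter.1 hkj
    rcases hσ₁ kj.1 with h1 | h1 <;> rcases hσ₁ (kj.1 - 1) with h2 | h2
    · exact absurd (h1.trans h2.symm) hne
    · exact Or.inl ⟨h2, h1⟩
    · exact Or.inr ⟨h2, h1⟩
    · exact absurd (h1.trans h2.symm) hne
  -- the «++» family (grain `L₁`)
  obtain ⟨hmem₁, hinj₁⟩ := rowBottomFamily_spec_apart σ₁ L₁ s₀ hσ₁ hX hsE hcert hσ₂ L₂ s₂ R₀ h ρ hR₀ hh hρ P₁ P₂ hP₁X hP₂X hcell hP₁ hP₂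
    hw₁s a₀ b₀ hw₁ hsteep hapart_pp (-R₀ - 4) ρin (by linarith) (by linarith) hρin'
    Tpp (fun kj => kj.1) ai bi hcc
    (fun kj hkj => (hfam kj (hTppTr kj hkj)).2.1) (fun kj hkj => (hfam kj (hTppTr kj hkj)).2.2.2.1)
    (fun kj hkj kj' hkj' heq => (hfam kj (hTppTr kj hkj)).2.2.2.2.2 kj' (hTppTr kj' hkj') heq)
    (fun kj hkj => by have := (hfam kj (hTppTr kj hkj)).2.2.2.2.1; rw [hρin]; linarith) hNfuel
  -- the «−−» family (grain `G₁`)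
  obtain ⟨hmem₂, hinj₂⟩ := rowTwinFamily_spec_apart σ₁ L₁ s₀ hσ₁ hX hsE hcert hσ₂ L₂ s₂ R₀ h ρ hR₀ hh hρ P₁ P₂ hP₁X hP₂X hcell hP₁ hP₂
    hw₁s a₀ b₀ hw₁ hsteep hapart_mm (-R₀ - 4) ρin (by linarith) (by linarith) hρin'
    Tmm (fun kj => kj.1) ai bi hmm
    (fun kj hkj => (hfam kj (hTmmTr kj hkj)).2.1) (fun kj hkj => (hfam kj (hTmmTr kj hkj)).2.2.2.1)
    (fun kj hkj kj' hkj' heq => (hfam kj (hTmmTr kj hkj)).2.2.2.2.2 kj' (hTmmTr kj' hkj') heq)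
    (fun kj hkj => by have := (hfam kj (hTmmTr kj hkj)).2.2.2.2.1; rw [hρin]; linarith) hNfuel
  -- the h-row family: ends
  set f₃ : ℤ × ℤ → EuclideanSpace ℝ (Fin 3) := fun kj =>
    if σ₁ kj.1 = 1 then hRowRun X L₁ w₁ N (pos kj) else hRowRun X ((LinearIsometryEquiv.neg ℝ).trans L₁) (-w₁) N (pos kj) with hf₃
  have hbounds : ∀ kj ∈ Th, -(2 * R₀) + 2 ≤ (L₁ (bp kj.1 (ai kj) (bi kj)) + s₀) 2 ∧ (L₁ (bp kj.1 (ai kj) (bi kj)) + s₀) 2 ≤ -R₀ - 2 ∧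
      Real.sqrt ((L₁ (bp kj.1 (ai kj) (bi kj)) + s₀) 0 ^ 2 + (L₁ (bp kj.1 (ai kj) (bi kj)) + s₀) 1 ^ 2) + 4 / 3 * (h + 4 * R₀) + 5 ≤ ρ := by
    intro kj hkj
    have h1 := hposlo kj (hThTr kj hkj); have h2 := hposhi kj (hThTr kj hkj); have h3 := hposlat kj (hThTr kj hkj)
    simp only [hpos] at h1 h2 h3
    refine ⟨by linarith, by linarith, ?_⟩
    rw [hρin, hρw, hm] at h3
    have : 0 ≤ h + 4 * R₀ := by positivity
    linarith
  have hmem₃ : ∀ kj ∈ Th, (∃ n : ℕ, f₃ kj = pos kj + (n : ℝ) • L₁ w₁) ∧ f₃ kj ∈ PAY ∧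
      ∀ (F' : EuclideanSpace ℝ (Fin 3) ≃ₗᵢ[ℝ] EuclideanSpace ℝ (Fin 3)) (q : EuclideanSpace ℝ (Fin 3)), q ∈ fccSlots →
        (3 : ℝ) / 8 ≤ (F' q) 2 → ¬ WalkCertified12 X (f₃ kj) ⟨F', q, 0⟩ := by
    intro kj hkj
    obtain ⟨hlo, hhi, hlat⟩ := hbounds kj hkj
    rcases hAB kj hkj with ⟨hk', hk⟩ | ⟨hk', hk⟩
    · have hfeq : f₃ kj = hRowRun X L₁ w₁ N (pos kj) := by simp only [hf₃]; rw [if_pos hk]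
      obtain ⟨n, -, hrun, hPAY, hfar⟩ := hRow_member_A σ₁ L₁ s₀ hX hσ₁ hModel hJ hσ₂ L₂ s₂ R₀ h ρ hR₀4 hh hρ P₁ P₂ hP₁X hP₂X hcell hP₁ hP₂
        hw₁s a₀ b₀ hw₁ hrise hapart_h kj.1 (ai kj) (bi kj) hk' hk hlo hhi hlat hNfuel'
      rw [hfeq]
      exact ⟨⟨n, hrun⟩, hPAY, hfar⟩
    · have hfeq : f₃ kj = hRowRun X ((LinearIsometryEquiv.neg ℝ).trans L₁) (-w₁) N (pos kj) := by
        simp only [hf₃]; rw [if_neg (by rw [hk]; norm_num)]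
      obtain ⟨n, -, hrun, hPAY, hfar⟩ := hRow_member_B σ₁ L₁ s₀ hX hσ₁ hModel hJ hσ₂ L₂ s₂ R₀ h ρ hR₀4 hh hρ P₁ P₂ hP₁X hP₂X hcell hP₁ hP₂
        hw₁s a₀ b₀ hw₁ hrise hapart_h kj.1 (ai kj) (bi kj) hk' hk hlo hhi hlat hNfuel'
      rw [hfeq]
      exact ⟨⟨n, hrun⟩, hPAY, hfar⟩
  have hinj₃ : ∀ kj ∈ Th, ∀ kj' ∈ Th, f₃ kj = f₃ kj' → kj = kj' := by
    intro kj hkj kj' hkj' heq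
    obtain ⟨⟨n, hn⟩, -, -⟩ := hmem₃ kj hkj
    obtain ⟨⟨n', hn'⟩, -, -⟩ := hmem₃ kj' hkj'
    obtain ⟨i, hi⟩ := hpossite kj (hThTr kj hkj)
    obtain ⟨i', hi'⟩ := hpossite kj' (hThTr kj' hkj')
    rw [hn, hn', hi, hi'] at heq
    obtain ⟨h1, h2⟩ := layerRow_end_eq σ₁ L₁ s₀ e₃ hdet hw₁ hw₁' heq
    exact Prod.ext h1 h2
  have hdeg₃ : ∀ kj ∈ Th, (X.filter fun q => dist (f₃ kj) q = 1).card ≤ 11 := by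
    intro kj hkj
    obtain ⟨-, hPAY, -⟩ := hmem₃ kj hkj
    obtain ⟨-, hne, -, -⟩ := Finset.mem_filter.1 hPAY
    have := card_filter_dist_eq_one_le_twelve X hX (f₃ kj)
    omega
  have hfar₃ : ∀ kj ∈ Th, ∀ (F' : EuclideanSpace ℝ (Fin 3) ≃ₗᵢ[ℝ] EuclideanSpace ℝ (Fin 3)) (q : EuclideanSpace ℝ (Fin 3)),
      q ∈ fccSlots → (3 : ℝ) / 8 ≤ ⟪F' q, e₃⟫_ℝ → ¬ WalkCertified12 X (f₃ kj) ⟨F', q, 0⟩ := by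
    intro kj hkj F' q hq hq'
    rw [he₃i] at hq'
    exact (hmem₃ kj hkj).2.2 F' q hq hq'
  -- the ledger
  have hH : ∀ q ∈ X, ⟪q, e₃⟫_ℝ ≤ h + 2 * R₀ := fun q hq => by rw [he₃i]; exact (hcell q hq).2.1
  have hcount := layerRows_card_le_payers hX hsE hcert hDS hCP hw₁s hw₁2 he₃n hH Tpp Tmm Th
    (fun kj => (pos kj, [⟨L₁, w₁, 0⟩])) (fun kj => (pos kj, [⟨G₁, w₁, 0⟩])) f₃ N
    (fun kj hkj => by
      obtain ⟨hI, hW, hlast, hC, hfuel, -⟩ := hmem₁ kj hkj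
      exact ⟨hI, hW, hlast, hC, hfuel⟩)
    (fun kj hkj => by
      obtain ⟨hI, hW, hlast, hC, hfuel, -⟩ := hmem₂ kj hkj
      exact ⟨hI, hW, hlast, hC, hfuel⟩)
    hinj₁ hinj₂ hinj₃ hdeg₃ hfar₃ PAY
    (fun kj hkj => (hmem₁ kj hkj).2.2.2.2.2) (fun kj hkj => (hmem₂ kj hkj).2.2.2.2.2) (fun kj hkj => (hmem₃ kj hkj).2.1)
  refine ⟨Tr, fun kj ⟨i, h1, h2, h3⟩ => ?_, ?_⟩
  · -- a window row site at lateral ≤ ρ − m = ρw is a ball of W₁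
    set q := L₁ (layerSite σ₁ L₁ e₃ kj.1 i kj.2) + s₀ with hq
    have h0 : 0 ≤ q 0 ^ 2 + q 1 ^ 2 := by positivity
    have hle : Real.sqrt (q 0 ^ 2 + q 1 ^ 2) ≤ ρ := by linarith only [h3, hm0]
    have hlat2 : q 0 ^ 2 + q 1 ^ 2 ≤ ρ ^ 2 := by
      have h7 := pow_le_pow_left₀ (Real.sqrt_nonneg _) hle 2
      rwa [Real.sq_sqrt h0] at h7
    have hqP : q ∈ P₁ := (hP₁ _).2 ⟨layerSite_mem_stacking σ₁ L₁ e₃ s₀ kj.1 i kj.2, by linarith only [h1, hR₀], by linarith only [h2], hlat2⟩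
    have hqW : q ∈ W₁ := by rw [hW₁, Finset.mem_filter]; exact ⟨hqP, h1, h2, h3⟩
    exact hTrin kj ⟨i, hqW⟩
  · rw [hcardTr]; push_cast; linarith

end Cell

/-! ### Edge-on plates have steep rows -/

/-- **`layerRise² ≥ (3/4)(1 − ⟪L e₃, e₃⟫²)`**: the lateral part of the pulled-back vertical is `1 − ⟪L e₃, e₃⟫²`. -/
theorem layerRise_sq_ge_of_axis (L : EuclideanSpace ℝ (Fin 3) ≃ₗᵢ[ℝ] EuclideanSpace ℝ (Fin 3)) :
    3 / 4 * (1 - ⟪L (EuclideanSpace.single (2 : Fin 3) (1 : ℝ)), EuclideanSpace.single (2 : Fin 3) (1 : ℝ)⟫_ℝ ^ 2) ≤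
      layerRise L (EuclideanSpace.single (2 : Fin 3) (1 : ℝ)) ^ 2 := by
  set e₃ : EuclideanSpace ℝ (Fin 3) := EuclideanSpace.single (2 : Fin 3) (1 : ℝ) with he₃
  have he₃n : ‖e₃‖ = 1 := by rw [he₃, PiLp.norm_single, norm_one]
  have h := three_quarters_lateral_le_layerRise_sq L e₃
  set ν := L.symm e₃ with hν
  have hνn : ‖ν‖ = 1 := by rw [hν, LinearIsometryEquiv.norm_map, he₃n]
  have hν2 : ν 2 = ⟪L e₃, e₃⟫_ℝ := by
    have : ⟪ν, e₃⟫_ℝ = ν 2 := by rw [he₃, EuclideanSpace.inner_single_right]; simp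
    rw [← this, hν, ← LinearIsometryEquiv.inner_map_map L, LinearIsometryEquiv.apply_symm_apply, real_inner_comm]
  have hsum : ν 0 ^ 2 + ν 1 ^ 2 + ν 2 ^ 2 = 1 := by
    have h1 : ‖ν‖ ^ 2 = ν 0 ^ 2 + ν 1 ^ 2 + ν 2 ^ 2 := by
      rw [EuclideanSpace.norm_eq, Real.sq_sqrt (Finset.sum_nonneg fun i _ => sq_nonneg _), Fin.sum_univ_three]
      simp only [Real.norm_eq_abs, sq_abs]
    rw [hνn, one_pow] at h1; linarith
  have : ν 0 ^ 2 + ν 1 ^ 2 = 1 - ⟪L e₃, e₃⟫_ℝ ^ 2 := by rw [← hν2]; linarith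
  rw [← this]; exact h

/-- **Edge-on plates have steep rows**: `⟪L e₃, e₃⟫² < 1/20` ⇒ `(L (bestLayerDir L e₃))₂ ≥ 3/4` (indeed `≥ √(57/80)`). -/
theorem rise_bestLayerDir_of_tilt (L : EuclideanSpace ℝ (Fin 3) ≃ₗᵢ[ℝ] EuclideanSpace ℝ (Fin 3))
    (htilt : ⟪L (EuclideanSpace.single (2 : Fin 3) (1 : ℝ)), EuclideanSpace.single (2 : Fin 3) (1 : ℝ)⟫_ℝ ^ 2 < 1 / 20) :
    (3 / 4 : ℝ) ≤ (L (bestLayerDir L (EuclideanSpace.single (2 : Fin 3) (1 : ℝ)))) 2 ∧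
      Real.sqrt 2 / 2 ≤ ⟪L (bestLayerDir L (EuclideanSpace.single (2 : Fin 3) (1 : ℝ))), EuclideanSpace.single (2 : Fin 3) (1 : ℝ)⟫_ℝ := by
  set e₃ : EuclideanSpace ℝ (Fin 3) := EuclideanSpace.single (2 : Fin 3) (1 : ℝ) with he₃
  have hkey : ⟪L (bestLayerDir L e₃), e₃⟫_ℝ = layerRise L e₃ := by
    rw [← LinearIsometryEquiv.inner_map_map L.symm, LinearIsometryEquiv.symm_apply_apply]
    exact Summit.Ventures.Crystal3D.Cruxes.TextureLiminf.TexShadow.inner_bestLayerDir L e₃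
  have h2 : (L (bestLayerDir L e₃)) 2 = layerRise L e₃ := by
    rw [← hkey, he₃, EuclideanSpace.inner_single_right]; simp
  have hsq := layerRise_sq_ge_of_axis L
  have hr0 := Summit.Ventures.Crystal3D.Cruxes.TextureLiminf.TexShadow.layerRise_nonneg L e₃
  have hge : (57 : ℝ) / 80 ≤ layerRise L e₃ ^ 2 := by
    have : 3 / 4 * (1 - ⟪L e₃, e₃⟫_ℝ ^ 2) ≥ 57 / 80 := by nlinarith
    linarith
  have h34 : (3 / 4 : ℝ) ≤ layerRise L e₃ := by nlinarith
  have hs : Real.sqrt 2 / 2 ≤ 3 / 4 := sqrt_two_div_two_le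
  exact ⟨by rw [h2]; exact h34, by rw [hkey]; linarith⟩

/-! ### R1 -/

/-- **LAYER ROWS R1 — `barlow_layerRows_inPlane_at`.**  Under E1 (`ExactOnly`), `DoubleStarCoaxialAt` / `CapPairCoaxial`, `HStarModel` (E1h)
and `HRowEndFar` ((J-b)): every Hägg pair whose plate 1 is within `arcsin √(1/20)` of edge-on and `LayerRowsApart` from plate 2 is row-certified
at `R₀ = 10` with `C_R1 = 2046` — lane T's `LayerRowsMachine LayerRowsApartReg 2046`. -/
theorem barlow_layerRows_inPlane_at
    {sE : EuclideanSpace ℝ (Fin 3)} (hsE : sE ∈ fccSlots) (hcert : ExactOnly 0 (fccSlots.filter fun w => 0 < ⟪w, sE⟫_ℝ))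
    (hDS : ∀ F₁ F₂ : EuclideanSpace ℝ (Fin 3) ≃ₗᵢ[ℝ] EuclideanSpace ℝ (Fin 3), DoubleStarCoaxialAt F₁ F₂) (hCP : CapPairCoaxial)
    (hModel : HStarModel) (hJ : HRowEndFar) :
    LayerRowsMachine LayerRowsApartReg 2046 := by
  intro σ₁ σ₂ L₁ L₂ s₁ s₂ hσ₁ hσ₂ htilt hreg h hh ρ hρ X P₁ P₂ hX hP₁X hP₂X' hcyl hP₁ hP₂
  classical
  have hapart : LayerRowsApart L₁ L₂ := hreg
  have hP₂X : P₂ ⊆ X := fun p hp => (Finset.mem_sdiff.1 (hP₂X' hp)).1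
  have hcell : ∀ p ∈ X, -(2 * (10 : ℝ)) ≤ p 2 ∧ p 2 ≤ h + 2 * 10 ∧ p 0 ^ 2 + p 1 ^ 2 ≤ ρ ^ 2 := fun p hp => hcyl p hp
  obtain ⟨hrise, hsteep⟩ := rise_bestLayerDir_of_tilt L₁ htilt
  obtain ⟨T, hT, hcount⟩ := barlow_layerRows_le_payers σ₁ L₁ s₁ hX hsE hcert hDS hCP hModel hJ hσ₁ hσ₂ L₂ s₂ 10 h ρ (by norm_num) hh
    (by linarith) P₁ P₂ hP₁X hP₂X hcell hP₁ hP₂ hsteep hrise hapart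
  refine ⟨7 + 8 / 3 * (h + 4 * 10), T, by positivity, hT, ?_⟩
  have hρ0 : 0 ≤ ρ := by linarith
  have hlin : 18 * (7 + 8 / 3 * (h + 4 * 10)) * ρ ≤ 2046 * (1 + h) * ρ := by
    apply mul_le_mul_of_nonneg_right _ hρ0
    nlinarith
  have key := add_le_add hcount hlin
  convert key using 2

end Summit.Ventures.Crystal3D.Theorems

end
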